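import Literature.MathematicalPhysics.QuantumLattice.HubbardLinkedCluster
import HarnessLib

/-!
# The determinant (Dyson–Wick) expansion of `Tr e^{-β(dΓ(h) + Σ_r v_r W_r)}` for words of pair monomials

Topic `MathematicalPhysics/QuantumLattice`; the generic companion of `HubbardDysonDeterminant.lean`
(`hasSum_hubbard_partitionFn_det`, on-site quartic vertices only). The perturbation is an arbitrary
finite family of PAIR MONOMIALS of a common length `p`,
`W_r = ∏_{q<p} c†_{op r q} c_{om r q}` (`r ∈ R`, ordered product), with complex weights `v_r`:
`H = dΓ(h) + g Σ_r v_r W_r`. A uniform number of pairs per letter is no restriction — a monomial with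
fewer pairs is padded by the CAR identity `c†_a c_b = (c†_a c_b)(c†_b c_b)` (`pad_pair`) — and it keeps
the bookkeeping of the vacuum chain (`Fin (m·p)`, vertex `⌊a/p⌋`, slot `a mod p`) free of dependent
pair counts; this is how quadratic counterterms / sources and quartic interactions are expanded
JOINTLY (mixed words, Benfatto–Giuliani–Mastropietro 2006 §2.1 with the `ν`-counterterm vertices;
Mastropietro 2008 §2.3). PROVED here:

* `prod_ofFn_mul_eq`, `wordPairMap` (+ `divNat_/modNat_/val_wordPairMap`, `wordPairMap_strictMono`,
  `mem_range_wordPairMap`), `card_filter_pairVertex_eq` — pair-index bookkeeping for `p` pairs per vertex;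
* `pairWord`, `pad_pair` — the letters and the padding identity;
* `wordPropMatrix`, `wordPropMatrix_submatrix_wordPairMap`, `continuous_wordPropMatrix_apply` — the
  `mp × mp` chronological propagator matrix of a word `f : Fin m → R` at times `s` and its restriction
  to sub-words;
* `gibbsState_dGamma_prod_pairWord_evolved_eq_det` — the free expectation of the evolved word is
  `det (wordPropMatrix)` (time-ordered Wick theorem);
* `wordIntegrand`, `continuous_wordIntegrand`, **`hasSum_partitionFn_pairWord_det`** —
  `Tr e^{-β(dΓ(h) + g Σ_r v_r W_r)} = Σ_m g^m ∫_{Δ_m} (-β)^m Σ_{f : [m] → R} (∏_i v_{f i}) Z₀ det G_f(-βw) dw`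
  for every complex `g` (finite volume).

Everything is PROVED; the definitions are bookkeeping (`wordPairMap`, `pairWord`, `wordPropMatrix`,
`wordIntegrand`).

## References
* G. Benfatto, A. Giuliani, V. Mastropietro, Ann. Henri Poincaré 7 (2006) 809–898, §2.1 (2.6)–(2.8).
  [cite: BenfattoGiulianiMastropietro2006, §2.1 (2.6)]
* V. Mastropietro, *Non-Perturbative Renormalization* (2008), §2.3. [cite: Mastropietro2008, §2.3]
* M. Gaudin, Nucl. Phys. 15 (1960) 89–91. [cite: Gaudin1960]
-/

noncomputable section

namespace Literature.MathematicalPhysics.QuantumLattice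

open NormedSpace Matrix Finset
open scoped ComplexOrder

/-! ### Pair indices `Fin (m·p)`: vertex `⌊a/p⌋`, slot `a mod p` -/

section PairIndex

variable {p j k : ℕ}

/-- Regrouping an ordered product over `Fin (m·p)` into `m` consecutive blocks of length `p`. [folklore] -/
theorem prod_ofFn_mul_eq {M : Type*} [Monoid M] (m p : ℕ) (g : Fin (m * p) → M) :
    (List.ofFn g).prod =
      (List.ofFn fun i : Fin m => (List.ofFn fun q : Fin p => g (finProdFinEquiv (i, q))).prod).prod := by
  rw [List.ofFn_mul, List.prod_flatten, List.map_ofFn]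
  congr 1
  refine List.ofFn_inj.mpr (funext fun i => ?_)
  simp only [Function.comp_apply]
  congr 1
  refine List.ofFn_inj.mpr (funext fun q => ?_)
  congr 1
  apply Fin.ext
  simp [finProdFinEquiv]
  ring

/-- Re-indexing the pairs along a map of vertices: `(i, q) ↦ (e i, q)`. [folklore] -/
def wordPairMap (e : Fin j → Fin k) (a : Fin (j * p)) : Fin (k * p) :=
  finProdFinEquiv (e (finProdFinEquiv.symm a).1, (finProdFinEquiv.symm a).2)

/-- Components of a re-indexed pair. [folklore] -/
theorem finProdFinEquiv_symm_wordPairMap (e : Fin j → Fin k) (a : Fin (j * p)) :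
    finProdFinEquiv.symm (wordPairMap e a) =
      (e (finProdFinEquiv.symm a).1, (finProdFinEquiv.symm a).2) := by
  simp [wordPairMap]

/-- The vertex of a re-indexed pair. [folklore] -/
@[simp] theorem divNat_wordPairMap (e : Fin j → Fin k) (a : Fin (j * p)) :
    (wordPairMap e a).divNat = e a.divNat := by
  have h := finProdFinEquiv_symm_wordPairMap e a
  rw [finProdFinEquiv_symm_apply, finProdFinEquiv_symm_apply, Prod.mk.injEq] at h
  exact h.1

/-- The slot of a re-indexed pair. [folklore] -/
@[simp] theorem modNat_wordPairMap (e : Fin j → Fin k) (a : Fin (j * p)) :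
    (wordPairMap e a).modNat = a.modNat := by
  have h := finProdFinEquiv_symm_wordPairMap e a
  rw [finProdFinEquiv_symm_apply, finProdFinEquiv_symm_apply, Prod.mk.injEq] at h
  exact h.2

/-- The value of a re-indexed pair: `(wordPairMap e a : ℕ) = a % p + p · e(a / p)`. [folklore] -/
theorem val_wordPairMap (e : Fin j → Fin k) (a : Fin (j * p)) :
    (wordPairMap e a : ℕ) = (a : ℕ) % p + p * (e (finProdFinEquiv.symm a).1 : ℕ) := by
  simp [wordPairMap, finProdFinEquiv, Fin.coe_modNat]

/-- Re-indexing pairs along a strictly monotone map of vertices is strictly monotone. [folklore] -/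
theorem wordPairMap_strictMono {e : Fin j → Fin k} (he : StrictMono e) :
    StrictMono (wordPairMap (p := p) e) := by
  intro a b hab
  rw [Fin.lt_def, val_wordPairMap, val_wordPairMap]
  have hab' : (a : ℕ) < b := hab
  rcases Nat.eq_zero_or_pos p with hp | hp
  · subst hp
    exact absurd a.2 (by simp)
  have hdiv : (a : ℕ) / p ≤ (b : ℕ) / p := Nat.div_le_div_right hab'.le
  have h1 : ((finProdFinEquiv.symm a).1 : ℕ) = (a : ℕ) / p := by simp [finProdFinEquiv, Fin.coe_divNat]
  have h2 : ((finProdFinEquiv.symm b).1 : ℕ) = (b : ℕ) / p := by simp [finProdFinEquiv, Fin.coe_divNat]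
  have hma : (a : ℕ) % p < p := Nat.mod_lt _ hp
  have hmb : (b : ℕ) % p < p := Nat.mod_lt _ hp
  rcases hdiv.lt_or_eq with hlt | heq
  · have hlt' : (finProdFinEquiv.symm a).1 < (finProdFinEquiv.symm b).1 := by
      rw [Fin.lt_def, h1, h2]; exact hlt
    have he' : (e (finProdFinEquiv.symm a).1 : ℕ) + 1 ≤ e (finProdFinEquiv.symm b).1 := he hlt'
    have h3 := Nat.mul_le_mul_left p he'
    rw [Nat.mul_succ] at h3
    omega
  · have heq' : (finProdFinEquiv.symm a).1 = (finProdFinEquiv.symm b).1 := by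
      apply Fin.ext; rw [h1, h2]; exact heq
    rw [heq']
    have ha := Nat.div_add_mod (a : ℕ) p
    have hb := Nat.div_add_mod (b : ℕ) p
    rw [heq] at ha
    omega

/-- A pair whose vertex lies in the range of `e` is a re-indexed pair. [folklore] -/
theorem mem_range_wordPairMap (e : Fin j ↪o Fin k) (a : Fin (k * p))
    (ha : (finProdFinEquiv.symm a).1 ∈ Set.range e) :
    a ∈ Set.range (OrderEmbedding.ofStrictMono (wordPairMap (p := p) e)
      (wordPairMap_strictMono e.strictMono)) := by
  obtain ⟨i, hi⟩ := ha
  refine ⟨finProdFinEquiv (i, (finProdFinEquiv.symm a).2), ?_⟩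
  rw [OrderEmbedding.coe_ofStrictMono]
  apply finProdFinEquiv.symm.injective
  rw [finProdFinEquiv_symm_wordPairMap, Equiv.symm_apply_apply]
  exact Prod.ext hi rfl

/-- Every vertex of a word with `p` pairs per letter carries exactly `p` pairs. [folklore] -/
theorem card_filter_pairVertex_eq (m p : ℕ) (x : Fin m) :
    (univ.filter fun a : Fin (m * p) => (finProdFinEquiv.symm a).1 = x).card = p := by
  have hset : (univ.filter fun a : Fin (m * p) => (finProdFinEquiv.symm a).1 = x) =
      (univ : Finset (Fin p)).map ⟨fun r => finProdFinEquiv (x, r), fun r r' hrr' => by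
        simpa using congrArg (fun a => (finProdFinEquiv.symm a).2) hrr'⟩ := by
    ext a
    simp only [Finset.mem_filter, Finset.mem_univ, true_and, Finset.mem_map,
      Function.Embedding.coeFn_mk]
    constructor
    · intro ha
      refine ⟨(finProdFinEquiv.symm a).2, ?_⟩
      apply finProdFinEquiv.symm.injective
      rw [Equiv.symm_apply_apply]
      exact Prod.ext ha.symm rfl
    · rintro ⟨r, rfl⟩
      simp
  rw [hset, Finset.card_map, Finset.card_univ, Fintype.card_fin]

end PairIndex

/-! ### Letters: pair monomials, and the padding identity -/

section Letters

variable {κ : Type*} [LinearOrder κ] [Fintype κ]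

/-- **The pair monomial of a letter**: `W_r = ∏_{q < p} c†_{op r q} c_{om r q}` (ordered product over the
slots). [cite: BenfattoGiulianiMastropietro2006, §2.1 (2.6)] -/
def pairWord {R : Type*} {p : ℕ} (op om : R → Fin p → κ) (r : R) : Matrix (Finset κ) (Finset κ) ℂ :=
  (List.ofFn fun q : Fin p => creation (op r q) * annihilation (om r q)).prod

/-- **Padding a pair by an idempotent**: `c†_a c_b = (c†_a c_b)(c†_b c_b)` (CAR: `c_b c†_b c_b = c_b`,
`c_b c_b = 0`). This writes a quadratic monomial as a monomial with two pairs. [folklore] -/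
theorem pad_pair (a b : κ) :
    creation a * annihilation b * (creation b * annihilation b) = creation a * annihilation b := by
  have hsq : annihilation b * annihilation b = (0 : Matrix (Finset κ) (Finset κ) ℂ) := by
    have h2 : (2 : ℂ) • (annihilation b * annihilation b) = 0 := by
      rw [two_smul]
      exact annihilation_anticommute_holds (ι := κ) b b
    exact (smul_eq_zero.1 h2).resolve_left two_ne_zero
  have key : annihilation b * (creation b * annihilation b) = annihilation b := by
    rw [← mul_assoc, annihilation_mul_creation, if_pos rfl, sub_mul, one_mul, mul_assoc, hsq, mul_zero,
      sub_zero]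
  rw [mul_assoc, key]

end Letters

/-! ### The propagator matrix of a word -/

section WordProp

variable {κ : Type*} [LinearOrder κ] [Fintype κ] (β : ℝ) (h : Matrix κ κ ℂ)
variable {R : Type*} {p : ℕ} (op om : R → Fin p → κ)

/-- **The `mp × mp` chronological propagator matrix of the word `W_{f 0}(s₀) ⋯ W_{f (m-1)}(s_{m-1})`**:
pair `a = (i, q)` carries the creation orbital `op (f i) q`, the annihilation orbital `om (f i) q` and
the time `s i` (`propMatrix`). BGM 2006 (2.6). [cite: BenfattoGiulianiMastropietro2006, §2.1 (2.6)] -/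
def wordPropMatrix {m : ℕ} (f : Fin m → R) (s : Fin m → ℂ) : Matrix (Fin (m * p)) (Fin (m * p)) ℂ :=
  propMatrix β h (fun a => op (f (finProdFinEquiv.symm a).1) (finProdFinEquiv.symm a).2)
    (fun a => om (f (finProdFinEquiv.symm a).1) (finProdFinEquiv.symm a).2)
    (fun a => s (finProdFinEquiv.symm a).1)

/-- **Restricting the word propagator matrix to the pairs of the vertices `e(Fin j)`** gives the word
propagator matrix of the sub-word. [folklore] -/
theorem wordPropMatrix_submatrix_wordPairMap {j k : ℕ} (f : Fin k → R) (s : Fin k → ℂ)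
    (e : Fin j ↪o Fin k) :
    (wordPropMatrix β h op om f s).submatrix
        (OrderEmbedding.ofStrictMono (wordPairMap (p := p) e) (wordPairMap_strictMono e.strictMono))
        (OrderEmbedding.ofStrictMono (wordPairMap (p := p) e) (wordPairMap_strictMono e.strictMono)) =
      wordPropMatrix β h op om (f ∘ e) (s ∘ e) := by
  unfold wordPropMatrix
  rw [propMatrix_submatrix]
  congr 1
  · funext a
    simp
  · funext a
    simp
  · funext a
    simp

/-- The entries of the word propagator matrix at the rescaled times `-β w_i` depend continuously on `w`.
[folklore] -/
theorem continuous_wordPropMatrix_apply {m : ℕ} (f : Fin m → R) (a b : Fin (m * p)) :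
    Continuous fun w : Fin m → ℝ =>
      wordPropMatrix β h op om f (fun i => ((w i : ℝ) : ℂ) * -(β : ℂ)) a b := by
  unfold wordPropMatrix
  exact continuous_propMatrix_apply β h _ _
    (τ := fun (w : Fin m → ℝ) (a : Fin (m * p)) => ((w (finProdFinEquiv.symm a).1 : ℝ) : ℂ) * -(β : ℂ))
    (fun a => continuous_time_coord β _) a b

end WordProp

/-! ### The time-ordered Wick theorem for words of pair monomials -/

section Wick

variable {κ : Type*} [LinearOrder κ] [Fintype κ]

/-- Conjugation distributes over an ordered product: `e^{X}(∏ l)e^{-X} = ∏ (e^{X} l e^{-X})`. [folklore] -/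
theorem exp_mul_list_prod_mul_exp_neg (X : Matrix (Finset κ) (Finset κ) ℂ) :
    ∀ l : List (Matrix (Finset κ) (Finset κ) ℂ),
      exp X * l.prod * exp (-X) = (l.map fun Y => exp X * Y * exp (-X)).prod
  | [] => by
    rw [List.prod_nil, List.map_nil, List.prod_nil, Matrix.mul_one,
      ← Matrix.exp_add_of_commute _ _ (Commute.refl X).neg_right, add_neg_cancel, exp_zero]
  | Y :: l => by
    rw [List.prod_cons, List.map_cons, List.prod_cons, exp_mul_mul_mul_exp_neg,
      exp_mul_list_prod_mul_exp_neg X l]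

variable {R : Type*} {p : ℕ} (op om : R → Fin p → κ)

/-- **The free expectation of an evolved word of pair monomials is the determinant of its propagator
matrix**: for Hermitian `h`, real `β`, letters `f : Fin m → R` and (complex) times `s`,
`⟨∏_i e^{s_i dΓ(h)} W_{f i} e^{-s_i dΓ(h)}⟩_{β, dΓ(h)} = det (wordPropMatrix β h op om f s)`
(time-ordered Wick theorem, `gibbsState_dGamma_prod_evolved_eq_det`, after distributing the evolution
over the `p` pairs of every letter). Gaudin 1960; BGM 2006 (2.6). [cite: Gaudin1960] -/
theorem gibbsState_dGamma_prod_pairWord_evolved_eq_det {h : Matrix κ κ ℂ} (hh : h.IsHermitian) (β : ℝ)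
    {m : ℕ} (f : Fin m → R) (s : Fin m → ℂ) :
    gibbsState β (dGamma h)
        (List.ofFn fun i : Fin m =>
          exp (s i • dGamma h) * pairWord op om (f i) * exp (-(s i • dGamma h))).prod =
      (wordPropMatrix β h op om f s).det := by
  have key := gibbsState_dGamma_prod_evolved_eq_det hh β
    (fun a : Fin (m * p) => op (f (finProdFinEquiv.symm a).1) (finProdFinEquiv.symm a).2)
    (fun a : Fin (m * p) => om (f (finProdFinEquiv.symm a).1) (finProdFinEquiv.symm a).2)
    (fun a => s (finProdFinEquiv.symm a).1) (fun a => s (finProdFinEquiv.symm a).1)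
  rw [prod_ofFn_mul_eq] at key
  simp only [Equiv.symm_apply_apply] at key
  have hconj : ∀ i : Fin m, exp (s i • dGamma h) * pairWord op om (f i) * exp (-(s i • dGamma h)) =
      (List.ofFn fun q : Fin p =>
        (exp (s i • dGamma h) * creation (op (f i) q) * exp (-(s i • dGamma h))) *
          (exp (s i • dGamma h) * annihilation (om (f i) q) * exp (-(s i • dGamma h)))).prod := by
    intro i
    rw [pairWord, exp_mul_list_prod_mul_exp_neg, List.map_ofFn]
    congr 1
    refine List.ofFn_inj.mpr (funext fun q => ?_)
    simp only [Function.comp_apply, exp_mul_mul_mul_exp_neg]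
  simp only [hconj]
  exact key

end Wick

/-! ### The Dyson series in determinant form -/

section Dyson

variable {κ : Type*} [LinearOrder κ] [Fintype κ] (β : ℝ) (h : Matrix κ κ ℂ)
variable {R : Type*} [Fintype R] {p : ℕ} (op om : R → Fin p → κ) (v : R → ℂ)

/-- **The integrand of the order-`m` coefficient of the word expansion**:
`B_m(w) = (-β)^m Σ_{f : [m] → R} (∏_i v_{f i}) · Z₀ · det G_f(-βw)`.
[cite: BenfattoGiulianiMastropietro2006, §2.1 (2.6)] -/
def wordIntegrand (Z₀ : ℂ) (m : ℕ) : (Fin m → ℝ) → ℂ := fun w =>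
  (-(β : ℂ)) ^ m * ∑ f : Fin m → R, (∏ i, v (f i)) *
    (Z₀ * (wordPropMatrix β h op om f (fun i => ((w i : ℝ) : ℂ) * -(β : ℂ))).det)

/-- The word integrand is continuous. [folklore] -/
theorem continuous_wordIntegrand (Z₀ : ℂ) (m : ℕ) : Continuous (wordIntegrand β h op om v Z₀ m) := by
  unfold wordIntegrand
  refine continuous_const.mul (continuous_finsetSum _ fun f _ => continuous_const.mul
    (continuous_const.mul ?_))
  exact Continuous.matrix_det (continuous_matrix fun a b => continuous_wordPropMatrix_apply β h op om f a b)

/-- **The Dyson series of `Tr e^{-β(dΓ(h) + g Σ_r v_r W_r)}` in determinant form (finite volume).**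
For Hermitian `h`, real `β`, letters `W_r = ∏_{q<p} c†_{op r q} c_{om r q}` with weights `v_r`, and every
complex `g`:
`Tr e^{-β(dΓ(h) + g Σ_r v_r W_r)} = Σ_m g^m ∫_{0 ≤ w₀ ≤ ⋯ ≤ w_{m-1} ≤ 1} (-β)^m Σ_{f : [m] → R} (∏_i v_{f i}) Z₀ det G_f(-βw) dw`,
`Z₀ = Tr e^{-β dΓ(h)}`, `G_f` the word propagator matrix (`wordPropMatrix`) — Dyson expansion
(`hasSum_dyson_trace_gibbsWeight_sum`) and the time-ordered Wick theorem
(`gibbsState_dGamma_prod_pairWord_evolved_eq_det`); an entire series in `g`.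
BGM 2006 §2.1 (2.6); Mastropietro 2008 §2.3. [cite: BenfattoGiulianiMastropietro2006, §2.1 (2.6)] -/
theorem hasSum_partitionFn_pairWord_det (hh : h.IsHermitian) (g : ℂ) :
    HasSum (fun m : ℕ => g ^ m *
        orderedIntegral m (wordIntegrand β h op om v (Matrix.partitionFn β (dGamma h)) m) 1)
      (Matrix.partitionFn β (dGamma h + g • ∑ r, v r • pairWord op om r)) := by
  haveI : Nonempty (Finset κ) := ⟨∅⟩
  have hZ : Matrix.partitionFn β (dGamma h) ≠ 0 :=
    (Matrix.partitionFn_pos β (isHermitian_dGamma hh)).ne'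
  have hs := hasSum_dyson_trace_gibbsWeight_sum β (dGamma h) 1 v (fun r => pairWord op om r) g
  simp only [Matrix.one_mul, Matrix.mul_one] at hs
  refine hs.congr_fun fun m => ?_
  refine congrArg (fun F => g ^ m * orderedIntegral m F 1) (funext fun w => ?_)
  unfold wordIntegrand
  refine congrArg (fun S => (-(β : ℂ)) ^ m * S) (Finset.sum_congr rfl fun f _ => ?_)
  congr 1
  rw [← gibbsState_dGamma_prod_pairWord_evolved_eq_det op om hh β f
    (fun i : Fin m => ((w i : ℝ) : ℂ) * -(β : ℂ)), Matrix.gibbsState_apply, mul_inv_cancel_left₀ hZ]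

end Dyson

end Literature.MathematicalPhysics.QuantumLattice
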